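import Summits.QuantumFields.BalabanUV.T4Continuum.Support.VariationalColourTaxiTowerEndClass
import Summits.QuantumFields.BalabanUV.T4Continuum.Support.VariationalVectorEndOfLeaves
import Summits.QuantumFields.BalabanUV.T4Continuum.Support.CovariantBlockReversePoincare

/-!
# T⁴ programme, spine node NE2 (U1a), lane P2 — «V-AVG-G AT TAXI DATA», file 2b: THE (G″) DEFECT `ε″_k` DECAYS GEOMETRICALLY UNDER THE PLAQUETTE CLASS
# (real arithmetic only; rate `θ` with `θ² ≥ L⁻¹` — the half exponent of the harmonic-approximation defect `√e_H`; model level; cell `pub-balaban`)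

NE2 formalisation swarm `b2b-balaban-t4-ne2-formalise-*`, leaf prover 10 GEN 5 (`prover-b2b-balaban-t4-ne2-formalise-leaf-10-g5-0`, V-END holder lineage); item
«V-AVG-G AT TAXI DATA» (CLAIMS.log 2026-08-20, ONLINE gen 5), file F2b.  Over `VariationalVectorEndOfLeaves.{eV, ePV, eV_level_le, ePV_level_le}` (leaf-10-g3 p220074),
`VariationalColourTaxiTowerEndClass.blockDefect_le_of_class` (leaf-04-g5) and `CovariantBlockReversePoincare.revPC` BY NAME; nothing defined.

THE STATEMENT (`epsAvgG_le_of_class`).  File 2's (G″) defect at level `k` of the taxi tower is (its `let` telescope, `n = L^k`, level plaquette `a_k`, one-step `b_k`)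
`ε″_k = ε_D + √(136·e_H) + δ_G` with `ε_D = √(3d)(2n⁻¹ + m + n·m)`, `m = (d−1)L(L−1)b_k`, `e_H = ePV Λ 136 C_R ε₁ δ′ + eV Λ 136 δ` (`ε₁ = (d∕4+½)L∕n²`,
`δ′ = √(2d(1+d²))·(nL·m₁)`, `m₁ = (d−1)(L−1)(2L−1)b_k`, `δ = √d·(n·m)`, `Λ`, `C_R` polynomial in `n·w′ = n(d−1)(n−1)a_k + 3` and `a_k n²`), `δ_G = 4·d(d(L(n−1)(L−1)b_k))·
revPC d (nL) ((d−1)(nL−1)b_k)`.  Under the scale-invariant plaquette class `(L^k)²a_k ≤ c`, `(L^{k+1})²b_k ≤ c` and a rate `θ ∈ [0,1]` with `L⁻¹ ≤ θ²`: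
  **`ε″_k ≤ C_ε″·θ^k`**, `C_ε″ = √(3d)(2 + 2(d−1)c) + √(136·E_H⋆) + 4d²c·R⋆`, `R⋆ = 4d·36^d(1+(d−1)c)²`, `E_H⋆ = ePV Λ⋆ 136 C_R⋆ ((d∕4+½)L) δ′⋆ + eV Λ⋆ 136 (√d(d−1)c)`,
  `δ′⋆ = √(2d(1+d²))·(2(d−1)Lc)`, `Λ_c⋆ = 2d·36^d((4+(d−1)c)² + 9)`, `C_R⋆ = 2Λ_c⋆ + 2dc + d²c²·136`, `Λ⋆ = Λ_c⋆ + (ε₁⋆C_R⋆ + 2δ′⋆√((1+ε₁⋆C_R⋆)136) + δ′⋆²136)(Λ_c⋆+1)`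
— every first-order quantity (`n⁻¹`, `m`, `n·m`, `nL·m₁`, `ε₁`, the frame distance `L(n−1)(L−1)b_k`) is `≤ const·θ^{2k}`, so `e_H ≤ E_H⋆·θ^{2k}` by the END's own rate
lemmas and ONLY `√e_H` costs the half exponent (memo `t4/T4-EST-NE2-P2-VEND.md` §0 (iii′) REMARK); `revPC`, `Λ`, `C_R` are k-UNIFORM.  Also `epsAvgG_nonneg`.

HONEST FRAMING (T4-DAG p. 1).  Real arithmetic about OUR typed constants; the thresholds (`36^d`, `revPC`) are quantitatively void (memo GF3COV §3); nothing printed is a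
hypothesis; no `def`, no `def … : Prop`, no `sorry`; axioms standard.  NOT an END statement; V-END with background ∕ NE2 NOT proved; NE3 OPEN; spine PROVED 0∕9
unchanged; rung (B)+1 on a fixed finite T⁴ — NOT infinite volume, NOT mass gap, NOT Clay.  HONEST DEPENDENCY (cell, verbatim): continuum YM on T⁴ ⇐ BetaPertH ∧ nine
spine estimates (0/9 proved); BetaPertH ⇐ (D1) ∧ (D4) ∧ CAP+tail; G-an2-4 gates asym, D1 and NE2/3/4.
-/

noncomputable section

namespace Summit.QuantumFields.BalabanUV.T4Continuum.VariationalColourTaxiTowerAvgGDecay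

open Finset
open Summit.QuantumFields.BalabanUV.T4Continuum.VariationalColourTaxiTransport (blockDefect_le_of_class)
open Summit.QuantumFields.BalabanUV.T4Continuum.VariationalVectorEndOfLeaves (eV ePV eV_nonneg ePV_nonneg eV_level_le ePV_level_le)
open Summit.QuantumFields.BalabanUV.T4Continuum.CovariantBlockReversePoincare (revPC revPC_nonneg)

variable {d : ℕ} (L : ℕ)

/-! ## §1 The first-order quantities of the class against `θ^{2k}` -/

/-- `(L^k)⁻¹ ≤ θ^{2k}` for `L⁻¹ ≤ θ²` (`1 ≤ L`). [folklore] -/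
theorem inv_pow_le_sq (hL : 1 ≤ L) {θ : ℝ} (hθL : (L : ℝ)⁻¹ ≤ θ ^ 2) (k : ℕ) : (((L ^ k : ℕ) : ℝ))⁻¹ ≤ (θ ^ k) ^ 2 := by
  have hL0 : (0 : ℝ) < L := by exact_mod_cast hL
  rw [Nat.cast_pow, ← inv_pow, ← pow_mul, mul_comm, pow_mul]
  exact pow_le_pow_left₀ (inv_nonneg.mpr hL0.le) hθL k

/-- the two class readings used below: `n·(L²b) ≤ c·θ^{2k}` and `n·a ≤ c·θ^{2k}` (`n = L^k`, `(nL)²b ≤ c`, `n²a ≤ c`, `n⁻¹ ≤ θ^{2k}`). [folklore] -/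
theorem first_order_le (hL : 1 ≤ L) {θ c ak bk : ℝ} (hθL : (L : ℝ)⁻¹ ≤ θ ^ 2) (k : ℕ) (ha0 : 0 ≤ ak)
    (hbc : (((L ^ (k + 1) : ℕ)) : ℝ) ^ 2 * bk ≤ c) (hac : (((L ^ k : ℕ)) : ℝ) ^ 2 * ak ≤ c) :
    ((L ^ k : ℕ) : ℝ) * ((L : ℝ) * L * bk) ≤ c * (θ ^ k) ^ 2 ∧ ((L ^ k : ℕ) : ℝ) * ak ≤ c * (θ ^ k) ^ 2 := by
  have hN1 : (1 : ℝ) ≤ ((L ^ k : ℕ) : ℝ) := by exact_mod_cast Nat.one_le_pow k L hL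
  have hN0 : (0 : ℝ) < ((L ^ k : ℕ) : ℝ) := by linarith
  have hc0 : 0 ≤ c := le_trans (by positivity) hac
  have hinv := inv_pow_le_sq L hL hθL k
  have hcast : (((L ^ (k + 1) : ℕ)) : ℝ) = ((L ^ k : ℕ) : ℝ) * L := by push_cast; ring
  rw [hcast] at hbc
  set N : ℝ := ((L ^ k : ℕ) : ℝ)
  constructor
  · -- `N·L²·b = N⁻¹·((N L)² b) ≤ N⁻¹·c ≤ c θ^{2k}`
    have e : N * ((L : ℝ) * L * bk) = N⁻¹ * ((N * L) ^ 2 * bk) := by field_simp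
    rw [e]
    calc N⁻¹ * ((N * L) ^ 2 * bk) ≤ N⁻¹ * c := mul_le_mul_of_nonneg_left hbc (inv_nonneg.mpr hN0.le)
      _ ≤ (θ ^ k) ^ 2 * c := mul_le_mul_of_nonneg_right hinv hc0
      _ = c * (θ ^ k) ^ 2 := mul_comm _ _
  · have e : N * ak = N⁻¹ * (N ^ 2 * ak) := by field_simp
    rw [e]
    calc N⁻¹ * (N ^ 2 * ak) ≤ N⁻¹ * c := mul_le_mul_of_nonneg_left hac (inv_nonneg.mpr hN0.le)
      _ ≤ (θ ^ k) ^ 2 * c := mul_le_mul_of_nonneg_right hinv hc0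
      _ = c * (θ ^ k) ^ 2 := mul_comm _ _

/-- `√(X·t²) = √X·t` for `0 ≤ t`. [folklore] -/
theorem sqrt_mul_sq {X t : ℝ} (ht : 0 ≤ t) : Real.sqrt (X * t ^ 2) = Real.sqrt X * t := by
  rw [Real.sqrt_mul' X (sq_nonneg t), Real.sqrt_sq ht]

/-! ## §2 The (G″) defect decays like `θ^k` -/

/-- **THE (G″) DEFECT OF FILE 2 DECAYS GEOMETRICALLY UNDER THE PLAQUETTE CLASS**: `ε″_k ≤ C_ε″·θ^k` for `θ ∈ [0,1]` with `L⁻¹ ≤ θ²`, `(L^k)²a_k ≤ c`,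
`(L^{k+1})²b_k ≤ c`, `1 ≤ d`, `2 ≤ L`; `C_ε″` as in the header (the `let` telescope repeats file 2's, then the starred constants). [folklore] -/
theorem epsAvgG_le_of_class (hL : 2 ≤ L) (hd : 1 ≤ d) {a b : ℕ → ℝ} {c θ : ℝ} (ha0 : ∀ k, 0 ≤ a k) (hb0 : ∀ k, 0 ≤ b k)
    (hac : ∀ k, (((L ^ k : ℕ)) : ℝ) ^ 2 * a k ≤ c) (hbc : ∀ k, (((L ^ (k + 1) : ℕ)) : ℝ) ^ 2 * b k ≤ c)
    (hθ0 : 0 ≤ θ) (hθ1 : θ ≤ 1) (hθL : (L : ℝ)⁻¹ ≤ θ ^ 2) (k : ℕ) :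
    let n : ℕ := L ^ k
    let w₀ : ℝ := ((d - 1 : ℕ) : ℝ) * ((n - 1 : ℕ) : ℝ) * a k
    let w' : ℝ := w₀ + 3 / (n : ℝ)
    let m : ℝ := ((d - 1 : ℕ) : ℝ) * L * ((L - 1 : ℕ) : ℝ) * b k
    let m₁ : ℝ := ((d - 1 : ℕ) : ℝ) * ((L - 1 : ℕ) : ℝ) * ((2 * L - 1 : ℕ) : ℝ) * b k
    let Λc : ℝ := 2 * d * (36 : ℝ) ^ d * ((1 + n * w') ^ 2 + 9)
    let CP : ℝ := 136
    let CR : ℝ := 2 * Λc + 2 * d * (a k * (n : ℝ) ^ 2) + (d : ℝ) ^ 2 * (a k * (n : ℝ) ^ 2) ^ 2 * CP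
    let ε₁ : ℝ := ((d : ℝ) / 4 + 1 / 2) * ((L : ℝ) / (n : ℝ) ^ 2)
    let δ' : ℝ := Real.sqrt (2 * d * (1 + (d : ℝ) ^ 2)) * ((n : ℝ) * L * m₁)
    let Λ : ℝ := Λc + (ε₁ * CR + 2 * δ' * Real.sqrt ((1 + ε₁ * CR) * CP) + δ' ^ 2 * CP) * (Λc + 1)
    let δ : ℝ := Real.sqrt d * ((n : ℝ) * m)
    let eH : ℝ := ePV Λ CP CR ε₁ δ' + eV Λ CP δ
    let εD : ℝ := Real.sqrt (3 * d) * (2 * (n : ℝ)⁻¹ + m + n * m)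
    let δG : ℝ := 4 * ((d : ℝ) * ((d : ℝ) * (((L : ℝ) * ((n - 1 : ℕ) : ℝ) * ((L - 1 : ℕ) : ℝ)) * b k))) * revPC d (n * L) (((d - 1 : ℕ) : ℝ) * ((n * L - 1 : ℕ) : ℝ) * b k)
    -- the starred (k-uniform) constants
    let Λcs : ℝ := 2 * d * (36 : ℝ) ^ d * ((4 + ((d - 1 : ℕ) : ℝ) * c) ^ 2 + 9)
    let CRs : ℝ := 2 * Λcs + 2 * d * c + (d : ℝ) ^ 2 * c ^ 2 * CP
    let ε₁s : ℝ := ((d : ℝ) / 4 + 1 / 2) * L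
    let δ's : ℝ := Real.sqrt (2 * d * (1 + (d : ℝ) ^ 2)) * (2 * ((d - 1 : ℕ) : ℝ) * L * c)
    let Λs : ℝ := Λcs + (ε₁s * CRs + 2 * δ's * Real.sqrt ((1 + ε₁s * CRs) * CP) + δ's ^ 2 * CP) * (Λcs + 1)
    let EHs : ℝ := ePV Λs CP CRs ε₁s δ's + eV Λs CP (Real.sqrt d * (((d - 1 : ℕ) : ℝ) * c))
    let RPs : ℝ := 4 * d * (36 : ℝ) ^ d * (1 + ((d - 1 : ℕ) : ℝ) * c) ^ 2
    εD + Real.sqrt (CP * eH) + δG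
      ≤ (Real.sqrt (3 * d) * (2 + 2 * (((d - 1 : ℕ) : ℝ) * c)) + Real.sqrt (CP * EHs) + 4 * (d : ℝ) ^ 2 * c * RPs) * θ ^ k := by
  intro n w₀ w' m m₁ Λc CP CR ε₁ δ' Λ δ eH εD δG Λcs CRs ε₁s δ's Λs EHs RPs
  have hL1 : 1 ≤ L := le_trans (by norm_num) hL
  have hLr : (1 : ℝ) ≤ L := by exact_mod_cast hL1
  have hN1 : (1 : ℝ) ≤ (n : ℝ) := by exact_mod_cast Nat.one_le_pow k L hL1
  have hN0 : (0 : ℝ) < (n : ℝ) := lt_of_lt_of_le one_pos hN1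
  have hd0 : (0 : ℝ) ≤ d := Nat.cast_nonneg d
  have hD0 : (0 : ℝ) ≤ ((d - 1 : ℕ) : ℝ) := Nat.cast_nonneg _
  have hc0 : 0 ≤ c := le_trans (by have := ha0 k; positivity) (hac k)
  set D : ℝ := ((d - 1 : ℕ) : ℝ) with hDdef
  set t : ℝ := θ ^ k with htdef
  have ht0 : 0 ≤ t := pow_nonneg hθ0 k
  have ht1 : t ≤ 1 := pow_le_one₀ hθ0 hθ1
  have htt : t ^ 2 ≤ t := by rw [sq]; exact mul_le_of_le_one_left ht0 ht1
  have hinv : (n : ℝ)⁻¹ ≤ t ^ 2 := inv_pow_le_sq L hL1 hθL k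
  -- nonnegativity of the level quantities (proved first, while the context is small)
  have hbk : 0 ≤ b k := hb0 k
  have hak : 0 ≤ a k := ha0 k
  have hw₀0 : 0 ≤ w₀ := by positivity
  have hm0 : 0 ≤ m := by positivity
  have hm₁0 : 0 ≤ m₁ := by positivity
  have hCP0 : (0 : ℝ) ≤ CP := by norm_num
  have hΛc0 : 0 ≤ Λc := by positivity
  have hαk0 : 0 ≤ a k * (n : ℝ) ^ 2 := by positivity
  have hCR0 : 0 ≤ CR := by positivity
  have hε₁0 : 0 ≤ ε₁ := by positivity
  have hδ'0 : 0 ≤ δ' := by positivity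
  have hδ0 : 0 ≤ δ := by positivity
  have hΛ0 : 0 ≤ Λ := by positivity
  obtain ⟨hNLLb, hNa⟩ := first_order_le L hL1 hθL k (ha0 k) (hbc k) (hac k)
  -- casts of the truncated naturals
  have hL1r : ((L - 1 : ℕ) : ℝ) ≤ L := by exact_mod_cast Nat.sub_le L 1
  have h2L1 : ((2 * L - 1 : ℕ) : ℝ) ≤ 2 * L := by exact_mod_cast Nat.sub_le (2 * L) 1
  have hn1r : ((n - 1 : ℕ) : ℝ) ≤ (n : ℝ) := by exact_mod_cast Nat.sub_le n 1
  have hnL1r : ((n * L - 1 : ℕ) : ℝ) ≤ (n : ℝ) * L := by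
    have : ((n * L - 1 : ℕ) : ℝ) ≤ ((n * L : ℕ) : ℝ) := by exact_mod_cast Nat.sub_le (n * L) 1
    simpa [Nat.cast_mul] using this
  have hcastnL : (((n * L : ℕ)) : ℝ) = (n : ℝ) * L := by push_cast; rfl
  have hLLb : (L : ℝ) * L * b k ≤ c * t ^ 2 := by
    have : (L : ℝ) * L * b k ≤ (n : ℝ) * ((L : ℝ) * L * b k) := le_mul_of_one_le_left (by have := hb0 k; positivity) hN1
    exact this.trans hNLLb
  -- `m`, `n·m`
  have hL0 : (0 : ℝ) ≤ L := Nat.cast_nonneg L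
  have hLb1 : (L : ℝ) * ((L - 1 : ℕ) : ℝ) * b k ≤ (L : ℝ) * L * b k := mul_le_mul_of_nonneg_right (mul_le_mul_of_nonneg_left hL1r hL0) hbk
  have hm : m ≤ D * (c * t ^ 2) := by
    show ((d - 1 : ℕ) : ℝ) * L * ((L - 1 : ℕ) : ℝ) * b k ≤ D * (c * t ^ 2)
    rw [hDdef]
    calc ((d - 1 : ℕ) : ℝ) * L * ((L - 1 : ℕ) : ℝ) * b k = ((d - 1 : ℕ) : ℝ) * ((L : ℝ) * ((L - 1 : ℕ) : ℝ) * b k) := by ring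
      _ ≤ ((d - 1 : ℕ) : ℝ) * ((L : ℝ) * L * b k) := mul_le_mul_of_nonneg_left hLb1 (Nat.cast_nonneg _)
      _ ≤ ((d - 1 : ℕ) : ℝ) * (c * t ^ 2) := mul_le_mul_of_nonneg_left hLLb (Nat.cast_nonneg _)
  have hNm : (n : ℝ) * m ≤ D * (c * t ^ 2) := by
    show (n : ℝ) * (((d - 1 : ℕ) : ℝ) * L * ((L - 1 : ℕ) : ℝ) * b k) ≤ D * (c * t ^ 2)
    rw [hDdef]
    calc (n : ℝ) * (((d - 1 : ℕ) : ℝ) * L * ((L - 1 : ℕ) : ℝ) * b k) = ((d - 1 : ℕ) : ℝ) * ((n : ℝ) * ((L : ℝ) * ((L - 1 : ℕ) : ℝ) * b k)) := by ring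
      _ ≤ ((d - 1 : ℕ) : ℝ) * ((n : ℝ) * ((L : ℝ) * L * b k)) := mul_le_mul_of_nonneg_left (mul_le_mul_of_nonneg_left hLb1 hN0.le) (Nat.cast_nonneg _)
      _ ≤ ((d - 1 : ℕ) : ℝ) * (c * t ^ 2) := mul_le_mul_of_nonneg_left hNLLb (Nat.cast_nonneg _)
  -- (i) `ε_D`
  have hεD : εD ≤ Real.sqrt (3 * d) * (2 + 2 * (D * c)) * t := by
    have h1 : 2 * (n : ℝ)⁻¹ + m + n * m ≤ (2 + 2 * (D * c)) * t ^ 2 :=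
      calc 2 * (n : ℝ)⁻¹ + m + n * m ≤ 2 * t ^ 2 + D * (c * t ^ 2) + D * (c * t ^ 2) :=
            add_le_add (add_le_add (mul_le_mul_of_nonneg_left hinv (by norm_num)) hm) hNm
        _ = (2 + 2 * (D * c)) * t ^ 2 := by ring
    have h2 : (2 + 2 * (D * c)) * t ^ 2 ≤ (2 + 2 * (D * c)) * t := mul_le_mul_of_nonneg_left htt (by positivity)
    calc εD = Real.sqrt (3 * d) * (2 * (n : ℝ)⁻¹ + m + n * m) := rfl
      _ ≤ Real.sqrt (3 * d) * ((2 + 2 * (D * c)) * t) := mul_le_mul_of_nonneg_left (h1.trans h2) (Real.sqrt_nonneg _)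
      _ = Real.sqrt (3 * d) * (2 + 2 * (D * c)) * t := by ring
  -- (ii) `δ_G`
  have hτ : (L : ℝ) * ((n - 1 : ℕ) : ℝ) * ((L - 1 : ℕ) : ℝ) * b k ≤ c * t ^ 2 := by
    have h1 : (L : ℝ) * ((n - 1 : ℕ) : ℝ) * ((L - 1 : ℕ) : ℝ) * b k ≤ (n : ℝ) * ((L : ℝ) * L * b k) := by
      have := hb0 k
      have h2 : (L : ℝ) * ((n - 1 : ℕ) : ℝ) ≤ (L : ℝ) * n := mul_le_mul_of_nonneg_left hn1r (by positivity)
      calc (L : ℝ) * ((n - 1 : ℕ) : ℝ) * ((L - 1 : ℕ) : ℝ) * b k ≤ (L : ℝ) * n * L * b k := by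
            apply mul_le_mul_of_nonneg_right _ this
            exact mul_le_mul h2 hL1r (Nat.cast_nonneg _) (by positivity)
        _ = (n : ℝ) * ((L : ℝ) * L * b k) := by ring
    exact h1.trans hNLLb
  have hRP : revPC d (n * L) (D * ((n * L - 1 : ℕ) : ℝ) * b k) ≤ RPs := by
    have hx0 : 0 ≤ ((n * L : ℕ) : ℝ) * (D * ((n * L - 1 : ℕ) : ℝ) * b k) := by have := hb0 k; positivity
    have hx : ((n * L : ℕ) : ℝ) * (D * ((n * L - 1 : ℕ) : ℝ) * b k) ≤ D * c := by
      rw [hcastnL]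
      have hb' : ((n : ℝ) * L) ^ 2 * b k ≤ c := by
        have h := hbc k
        have e : (((L ^ (k + 1) : ℕ)) : ℝ) = (n : ℝ) * L := by
          show (((L ^ (k + 1) : ℕ)) : ℝ) = ((L ^ k : ℕ) : ℝ) * L
          push_cast; ring
        rwa [e] at h
      have := hb0 k
      calc (n : ℝ) * L * (D * ((n * L - 1 : ℕ) : ℝ) * b k) = D * (((n : ℝ) * L) * ((n * L - 1 : ℕ) : ℝ) * b k) := by ring
        _ ≤ D * (((n : ℝ) * L) * ((n : ℝ) * L) * b k) := by
            apply mul_le_mul_of_nonneg_left _ hD0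
            exact mul_le_mul_of_nonneg_right (mul_le_mul_of_nonneg_left hnL1r (by positivity)) this
        _ = D * (((n : ℝ) * L) ^ 2 * b k) := by ring
        _ ≤ D * c := mul_le_mul_of_nonneg_left hb' hD0
    show 4 * d * (36 : ℝ) ^ d * (1 + ((n * L : ℕ) : ℝ) * (D * ((n * L - 1 : ℕ) : ℝ) * b k)) ^ 2 ≤ 4 * d * (36 : ℝ) ^ d * (1 + D * c) ^ 2
    exact mul_le_mul_of_nonneg_left (pow_le_pow_left₀ (by positivity) (add_le_add_right hx 1) 2) (by positivity)
  have hRP0 : 0 ≤ revPC d (n * L) (D * ((n * L - 1 : ℕ) : ℝ) * b k) := revPC_nonneg _ _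
  have hRPs0 : 0 ≤ RPs := by positivity
  have hδG : δG ≤ 4 * (d : ℝ) ^ 2 * c * RPs * t := by
    have h1 : 4 * ((d : ℝ) * ((d : ℝ) * (((L : ℝ) * ((n - 1 : ℕ) : ℝ) * ((L - 1 : ℕ) : ℝ)) * b k))) ≤ 4 * (d : ℝ) ^ 2 * c * t ^ 2 := by
      have := mul_le_mul_of_nonneg_left hτ (by positivity : (0 : ℝ) ≤ 4 * (d : ℝ) ^ 2)
      calc 4 * ((d : ℝ) * ((d : ℝ) * (((L : ℝ) * ((n - 1 : ℕ) : ℝ) * ((L - 1 : ℕ) : ℝ)) * b k)))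
          = 4 * (d : ℝ) ^ 2 * ((L : ℝ) * ((n - 1 : ℕ) : ℝ) * ((L - 1 : ℕ) : ℝ) * b k) := by ring
        _ ≤ 4 * (d : ℝ) ^ 2 * (c * t ^ 2) := this
        _ = 4 * (d : ℝ) ^ 2 * c * t ^ 2 := by ring
    have h0 : 0 ≤ 4 * ((d : ℝ) * ((d : ℝ) * (((L : ℝ) * ((n - 1 : ℕ) : ℝ) * ((L - 1 : ℕ) : ℝ)) * b k))) := by have := hb0 k; positivity
    calc δG = 4 * ((d : ℝ) * ((d : ℝ) * (((L : ℝ) * ((n - 1 : ℕ) : ℝ) * ((L - 1 : ℕ) : ℝ)) * b k))) * revPC d (n * L) (D * ((n * L - 1 : ℕ) : ℝ) * b k) := rfl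
      _ ≤ (4 * (d : ℝ) ^ 2 * c * t ^ 2) * RPs := mul_le_mul h1 hRP hRP0 (by positivity)
      _ ≤ (4 * (d : ℝ) ^ 2 * c * t) * RPs := by
          apply mul_le_mul_of_nonneg_right _ hRPs0
          exact mul_le_mul_of_nonneg_left htt (by positivity)
      _ = 4 * (d : ℝ) ^ 2 * c * RPs * t := by ring
  -- (iii) `e_H`: the uniform bounds `Λ ≤ Λ⋆`, `C_R ≤ C_R⋆` and the decay of `ε₁`, `δ′`, `δ`
  have hnw₀ : (n : ℝ) * w₀ ≤ D * c := blockDefect_le_of_class (d := d) L k (ha0 k) (hac k)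
  have hnw' : (n : ℝ) * w' = n * w₀ + 3 := by
    show (n : ℝ) * (w₀ + 3 / (n : ℝ)) = n * w₀ + 3
    field_simp
  have hΛc : Λc ≤ Λcs := by
    have h1 : (1 + (n : ℝ) * w') ^ 2 ≤ (4 + D * c) ^ 2 := by
      rw [hnw']
      exact pow_le_pow_left₀ (by positivity) (by linarith only [hnw₀]) 2
    show 2 * d * (36 : ℝ) ^ d * ((1 + n * w') ^ 2 + 9) ≤ 2 * d * (36 : ℝ) ^ d * ((4 + D * c) ^ 2 + 9)
    exact mul_le_mul_of_nonneg_left (add_le_add_left h1 9) (by positivity)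
  have hαk : a k * (n : ℝ) ^ 2 ≤ c := by rw [mul_comm]; exact hac k
  have hCR : CR ≤ CRs := by
    have h2 : (d : ℝ) ^ 2 * (a k * (n : ℝ) ^ 2) ^ 2 * CP ≤ (d : ℝ) ^ 2 * c ^ 2 * CP :=
      mul_le_mul_of_nonneg_right (mul_le_mul_of_nonneg_left (pow_le_pow_left₀ hαk0 hαk 2) (by positivity)) hCP0
    have h3 : (d : ℝ) * (a k * (n : ℝ) ^ 2) ≤ d * c := mul_le_mul_of_nonneg_left hαk hd0
    show 2 * Λc + 2 * d * (a k * (n : ℝ) ^ 2) + (d : ℝ) ^ 2 * (a k * (n : ℝ) ^ 2) ^ 2 * CP ≤ 2 * Λcs + 2 * d * c + (d : ℝ) ^ 2 * c ^ 2 * CP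
    linarith only [hΛc, h2, h3]
  have hCRs0 : 0 ≤ CRs := hCR0.trans hCR
  have hε₁t : ε₁ ≤ ε₁s * t ^ 2 := by
    have h1 : (L : ℝ) / (n : ℝ) ^ 2 ≤ L * t ^ 2 := by
      rw [div_eq_mul_inv]
      refine mul_le_mul_of_nonneg_left ?_ (by positivity)
      have hi0 : 0 ≤ (n : ℝ)⁻¹ := inv_nonneg.mpr hN0.le
      have hi1 : (n : ℝ)⁻¹ ≤ 1 := inv_le_one_of_one_le₀ hN1
      calc ((n : ℝ) ^ 2)⁻¹ = (n : ℝ)⁻¹ * (n : ℝ)⁻¹ := by rw [sq, mul_inv]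
        _ ≤ (n : ℝ)⁻¹ * 1 := mul_le_mul_of_nonneg_left hi1 hi0
        _ ≤ t ^ 2 := by rw [mul_one]; exact hinv
    show ((d : ℝ) / 4 + 1 / 2) * ((L : ℝ) / (n : ℝ) ^ 2) ≤ ((d : ℝ) / 4 + 1 / 2) * L * t ^ 2
    rw [mul_assoc]
    exact mul_le_mul_of_nonneg_left h1 (by positivity)
  have hε₁s0 : 0 ≤ ε₁s := by positivity
  have hε₁s : ε₁ ≤ ε₁s := hε₁t.trans (mul_le_of_le_one_right hε₁s0 (htt.trans ht1))
  have hnLm₁ : (n : ℝ) * L * m₁ ≤ 2 * D * L * c * t ^ 2 := by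
    have := hb0 k
    have h1 : m₁ ≤ D * (L * (2 * L)) * b k := by
      show D * ((L - 1 : ℕ) : ℝ) * ((2 * L - 1 : ℕ) : ℝ) * b k ≤ D * (L * (2 * L)) * b k
      apply mul_le_mul_of_nonneg_right _ this
      rw [mul_assoc D]
      exact mul_le_mul_of_nonneg_left (mul_le_mul hL1r h2L1 (Nat.cast_nonneg _) (by positivity)) hD0
    calc (n : ℝ) * L * m₁ ≤ (n : ℝ) * L * (D * (L * (2 * L)) * b k) := mul_le_mul_of_nonneg_left h1 (by positivity)
      _ = 2 * D * L * ((n : ℝ) * ((L : ℝ) * L * b k)) := by ring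
      _ ≤ 2 * D * L * (c * t ^ 2) := mul_le_mul_of_nonneg_left hNLLb (by positivity)
      _ = 2 * D * L * c * t ^ 2 := by ring
  have hδ't : δ' ≤ δ's * t ^ 2 := by
    show Real.sqrt (2 * d * (1 + (d : ℝ) ^ 2)) * ((n : ℝ) * L * m₁) ≤ Real.sqrt (2 * d * (1 + (d : ℝ) ^ 2)) * (2 * D * L * c) * t ^ 2
    calc Real.sqrt (2 * d * (1 + (d : ℝ) ^ 2)) * ((n : ℝ) * L * m₁) ≤ Real.sqrt (2 * d * (1 + (d : ℝ) ^ 2)) * (2 * D * L * c * t ^ 2) :=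
          mul_le_mul_of_nonneg_left hnLm₁ (Real.sqrt_nonneg _)
      _ = Real.sqrt (2 * d * (1 + (d : ℝ) ^ 2)) * (2 * D * L * c) * t ^ 2 := by ring
  have hδ's0 : 0 ≤ δ's := by positivity
  have hδ's : δ' ≤ δ's := hδ't.trans (mul_le_of_le_one_right hδ's0 (htt.trans ht1))
  have hδt : δ ≤ Real.sqrt d * (D * c) * t ^ 2 := by
    show Real.sqrt d * ((n : ℝ) * m) ≤ Real.sqrt d * (D * c) * t ^ 2
    rw [mul_assoc]
    exact mul_le_mul_of_nonneg_left (hNm.trans_eq (by ring)) (Real.sqrt_nonneg _)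
  have hΛcs0 : 0 ≤ Λcs := hΛc0.trans hΛc
  have hΛ : Λ ≤ Λs := by
    have hX : ε₁ * CR ≤ ε₁s * CRs := mul_le_mul hε₁s hCR hCR0 hε₁s0
    have hX0 : 0 ≤ ε₁ * CR := mul_nonneg hε₁0 hCR0
    have hS : Real.sqrt ((1 + ε₁ * CR) * CP) ≤ Real.sqrt ((1 + ε₁s * CRs) * CP) :=
      Real.sqrt_le_sqrt (mul_le_mul_of_nonneg_right (add_le_add_right hX 1) hCP0)
    have hS0 : 0 ≤ Real.sqrt ((1 + ε₁ * CR) * CP) := Real.sqrt_nonneg _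
    have hY : 2 * δ' * Real.sqrt ((1 + ε₁ * CR) * CP) ≤ 2 * δ's * Real.sqrt ((1 + ε₁s * CRs) * CP) :=
      mul_le_mul (mul_le_mul_of_nonneg_left hδ's (by norm_num)) hS hS0 (by positivity)
    have hZ : δ' ^ 2 * CP ≤ δ's ^ 2 * CP := mul_le_mul_of_nonneg_right (pow_le_pow_left₀ hδ'0 hδ's 2) hCP0
    have hB : ε₁ * CR + 2 * δ' * Real.sqrt ((1 + ε₁ * CR) * CP) + δ' ^ 2 * CP ≤ ε₁s * CRs + 2 * δ's * Real.sqrt ((1 + ε₁s * CRs) * CP) + δ's ^ 2 * CP :=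
      add_le_add (add_le_add hX hY) hZ
    have hB0 : 0 ≤ ε₁ * CR + 2 * δ' * Real.sqrt ((1 + ε₁ * CR) * CP) + δ' ^ 2 * CP := by positivity
    show Λc + (ε₁ * CR + 2 * δ' * Real.sqrt ((1 + ε₁ * CR) * CP) + δ' ^ 2 * CP) * (Λc + 1)
        ≤ Λcs + (ε₁s * CRs + 2 * δ's * Real.sqrt ((1 + ε₁s * CRs) * CP) + δ's ^ 2 * CP) * (Λcs + 1)
    exact add_le_add hΛc (mul_le_mul hB (add_le_add_left hΛc 1) (by positivity) (hB0.trans hB))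
  -- `e_H ≤ E_H⋆·θ^{2k}` by the END's rate lemmas at rate `θ²`
  have hθ20 : 0 ≤ θ ^ 2 := sq_nonneg θ
  have hθ21 : θ ^ 2 ≤ 1 := pow_le_one₀ hθ0 hθ1
  have hθ2k : (θ ^ 2) ^ k = t ^ 2 := by rw [← pow_mul, mul_comm, pow_mul]
  have hePV : ePV Λ CP CR ε₁ δ' ≤ ePV Λs CP CRs ε₁s δ's * t ^ 2 := by
    have h := ePV_level_le k hΛ0 hΛ hCP0 le_rfl hCR0 hCR hε₁0 hε₁s0 hδ'0 hδ's0 hθ20 hθ21 (by rw [hθ2k]; exact hε₁t) (by rw [hθ2k]; exact hδ't)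
    rwa [hθ2k] at h
  have heV : eV Λ CP δ ≤ eV Λs CP (Real.sqrt d * (D * c)) * t ^ 2 := by
    have h := eV_level_le k hΛ0 hΛ hCP0 le_rfl hδ0 hθ20 hθ21 (by rw [hθ2k]; exact hδt)
    rwa [hθ2k] at h
  have hEHs0 : 0 ≤ EHs := by
    have hΛs0 : 0 ≤ Λs := hΛ0.trans hΛ
    exact add_nonneg (ePV_nonneg hΛs0 hCP0 hCRs0 hε₁s0 hδ's0) (eV_nonneg hΛs0 hCP0 (by positivity))
  have heH : eH ≤ EHs * t ^ 2 := by
    show ePV Λ CP CR ε₁ δ' + eV Λ CP δ ≤ (ePV Λs CP CRs ε₁s δ's + eV Λs CP (Real.sqrt d * (D * c))) * t ^ 2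
    rw [add_mul]
    exact add_le_add hePV heV
  have hsq : Real.sqrt (CP * eH) ≤ Real.sqrt (CP * EHs) * t := by
    have h1 : CP * eH ≤ CP * EHs * t ^ 2 := by rw [mul_assoc]; exact mul_le_mul_of_nonneg_left heH hCP0
    calc Real.sqrt (CP * eH) ≤ Real.sqrt (CP * EHs * t ^ 2) := Real.sqrt_le_sqrt h1
      _ = Real.sqrt (CP * EHs) * t := sqrt_mul_sq ht0
  -- sum
  calc εD + Real.sqrt (CP * eH) + δG
      ≤ Real.sqrt (3 * d) * (2 + 2 * (D * c)) * t + Real.sqrt (CP * EHs) * t + 4 * (d : ℝ) ^ 2 * c * RPs * t := add_le_add (add_le_add hεD hsq) hδG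
    _ = (Real.sqrt (3 * d) * (2 + 2 * (D * c)) + Real.sqrt (CP * EHs) + 4 * (d : ℝ) ^ 2 * c * RPs) * t := by ring

/-- the (G″) defect is nonnegative (same `let` telescope as `epsAvgG_le_of_class`). [folklore] -/
theorem epsAvgG_nonneg {a b : ℕ → ℝ} (hb0 : ∀ k, 0 ≤ b k) (k : ℕ) :
    let n : ℕ := L ^ k
    let w₀ : ℝ := ((d - 1 : ℕ) : ℝ) * ((n - 1 : ℕ) : ℝ) * a k
    let w' : ℝ := w₀ + 3 / (n : ℝ)
    let m : ℝ := ((d - 1 : ℕ) : ℝ) * L * ((L - 1 : ℕ) : ℝ) * b k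
    let m₁ : ℝ := ((d - 1 : ℕ) : ℝ) * ((L - 1 : ℕ) : ℝ) * ((2 * L - 1 : ℕ) : ℝ) * b k
    let Λc : ℝ := 2 * d * (36 : ℝ) ^ d * ((1 + n * w') ^ 2 + 9)
    let CP : ℝ := 136
    let CR : ℝ := 2 * Λc + 2 * d * (a k * (n : ℝ) ^ 2) + (d : ℝ) ^ 2 * (a k * (n : ℝ) ^ 2) ^ 2 * CP
    let ε₁ : ℝ := ((d : ℝ) / 4 + 1 / 2) * ((L : ℝ) / (n : ℝ) ^ 2)
    let δ' : ℝ := Real.sqrt (2 * d * (1 + (d : ℝ) ^ 2)) * ((n : ℝ) * L * m₁)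
    let Λ : ℝ := Λc + (ε₁ * CR + 2 * δ' * Real.sqrt ((1 + ε₁ * CR) * CP) + δ' ^ 2 * CP) * (Λc + 1)
    let δ : ℝ := Real.sqrt d * ((n : ℝ) * m)
    let eH : ℝ := ePV Λ CP CR ε₁ δ' + eV Λ CP δ
    let εD : ℝ := Real.sqrt (3 * d) * (2 * (n : ℝ)⁻¹ + m + n * m)
    let δG : ℝ := 4 * ((d : ℝ) * ((d : ℝ) * (((L : ℝ) * ((n - 1 : ℕ) : ℝ) * ((L - 1 : ℕ) : ℝ)) * b k))) * revPC d (n * L) (((d - 1 : ℕ) : ℝ) * ((n * L - 1 : ℕ) : ℝ) * b k)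
    0 ≤ εD + Real.sqrt (CP * eH) + δG := by
  intro n w₀ w' m m₁ Λc CP CR ε₁ δ' Λ δ eH εD δG
  have hbk : 0 ≤ b k := hb0 k
  have hm0 : 0 ≤ m := by positivity
  have hεD : 0 ≤ εD := by positivity
  have hδG : 0 ≤ δG := by
    have := revPC_nonneg (d := d) (n * L) (((d - 1 : ℕ) : ℝ) * ((n * L - 1 : ℕ) : ℝ) * b k)
    positivity
  have hs : 0 ≤ Real.sqrt (CP * eH) := Real.sqrt_nonneg _
  exact add_nonneg (add_nonneg hεD hs) hδG

end Summit.QuantumFields.BalabanUV.T4Continuum.VariationalColourTaxiTowerAvgGDecay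

end
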